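import Summits.ResolutionOfSingularities.ResolutionOfSingularities.Theorems.WildQuotientsSummitReductionSemiStablePairLemmas
import Literature.AlgebraicGeometry.Resolution.QuasiSplitSemiStableCurveFibrations
import Literature.AlgebraicGeometry.Resolution.AlterationsProofs
import HarnessLib

/-!
# `WildQuotients.SummitReduction` (stmt-ResolutionOfSingularities-16324), line `FramePerfect`,
# skeleton v10: stub `stub_pair_equivariantSemiStableReduction_of_deJong59` (GLUE — stub 1b of the
# induction step from de Jong 1997, Thm. 5.9 in relative dimension `1`)

Route `ResolutionOfSingularities/WildQuotients`, crux `SummitReduction`; registered stub of the line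
skeleton `Cruxes/SummitReduction/Lines/FramePerfect.lean` (v10, lead c4). Worker file.

The line proves de Jong's equivariant alteration theorem in pair format by induction on `dim X`.
The first half of the induction step (de Jong 1997, proof of Thm. 5.13) replaces the projective
`G`-variety `X` with its `G`-stable closed `Z ≠ X` by a `G`-equivariant modification `φ : X' → X`
carrying a `G`-equivariant fibration `fc : X' → Y` in geometrically irreducible curves over a
projective `G`-variety `Y` of dimension `d` (stub 1a, landed), and then applies **de Jong 1997,
Thm. 5.9 with `d = 1`** (= Thm. 2.4 + Rem. 2.5 + Lemma 5.7 + (5.4.1)) to `(fc, G, φ⁻¹ Z)`: this is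
stub 1b. Thm. 5.9 for curve fibrations over a projective base is vendored in Literature as the
named fact `DeJong1997_quasiSplitSemiStableCurveFibration`
(`Literature/AlgebraicGeometry/Resolution/QuasiSplitSemiStableCurveFibrations.lean`); this file is
the GLUE deriving stub 1b's conclusion from it:

* the input `φ⁻¹ Z` is closed (continuity), `≠ X'` (`φ` is dominant and `X ∖ Z` is a non-empty
  open) and `G`-stable (`φ` is equivariant and `Z` is `G`-stable);
* the output `(G₁, X₁ → S₁, ψ : S₁ → Y, φ₁ : X₁ → X', χ : G₁ ↠ G, D, σ)` of the fact is repackaged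
  with `Y₁ := S₁`, `q₁ := ψ ≫ q`, `π₁ := φ₁ ≫ φ`, `D₁ := D`: the action on `S₁` is over `k`
  because `ψ` is equivariant and the action on `Y` is over `k`; `dim S₁ = dim Y = d`;
  `(ρS₁ g) '' D = D` from `⊆` for every `g` (apply it to `g⁻¹`); `π₁` is an alteration (an
  alteration followed by a modification, de Jong 1996, 2.20) and `χ`-equivariant; the purely
  inseparable invariants clause for `φ₁` (target `X'`) is pushed down to `X` along the
  `G`-equivariant modification `φ`, whose function field map `φ♯ : K(X) ⥲ K(X')` is bijective and
  commutes with the actions (exponent `0`, `ringExpChar K(X') = ringExpChar K(X)` along `φ♯`), using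
  `(φ₁ ≫ φ)♯ = φ₁♯ ∘ φ♯`; and `π₁⁻¹ Z = φ₁⁻¹ (φ⁻¹ Z) ⊆ ⋃ⱼ σⱼ(S₁) ∪ f₁⁻¹(D)`.

## References

* [DeJong1997] A. J. de Jong, *Families of curves and alterations*, Ann. Inst. Fourier 47 (1997)
  599–621: 5.3–5.4 (Galois alterations, p. 613–614), Situation 5.8 and Thm. 5.9 (pp. 615–617),
  proof of Thm. 5.13 (p. 619).
* [DeJong1996] A. J. de Jong, *Smoothness, semi-stability and alterations*, Publ. Math. IHÉS 83
  (1996) 51–93: 2.17 (modifications), 2.20 (alterations compose), pp. 59–61.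
-/

set_option linter.dupNamespace false

noncomputable section

open CategoryTheory CategoryTheory.Limits AlgebraicGeometry TopologicalSpace
open Literature.AlgebraicGeometry.Resolution
open Literature.AlgebraicGeometry.Motives (RatFn.functionFieldMap RatFn.functionFieldMap_comp)
open Literature.AlgebraicGeometry

namespace Summit.ResolutionOfSingularities.ResolutionOfSingularities.Theorems

/-- **Stub 1b of the induction step from de Jong 1997, Thm. 5.9 (`d = 1`)** (GLUE). Let `X` be a
projective integral `G`-scheme over the field `k` with a `G`-stable closed `Z ≠ X`, `φ : X' → X` a
`G`-equivariant modification with `X'` projective over `k`, and `fc : X' → Y` a `G`-equivariant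
morphism to a projective integral `G`-scheme `Y` over `k` of dimension `d` whose generic fibre is a
geometrically irreducible curve. Granting de Jong 1997, Thm. 5.9 for curve fibrations over a
projective base (`h59 : DeJong1997_quasiSplitSemiStableCurveFibration`), there are a finite group
`G₁ ↠ G`, a `G₁`-equivariant quasi-split semi-stable curve `f₁ : X₁ → Y₁` of integral projective
`G₁`-schemes over `k`, `dim Y₁ ≤ d`, smooth off a `G₁`-stable closed `D₁ ≠ Y₁`, with geometrically
irreducible generic fibre and finitely many pairwise disjoint `G₁`-permuted sections into the
smooth locus, together with a `G₁`-equivariant alteration `π₁ : X₁ → X` over `k` such that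
`K(X)^G ⊂ K(X₁)^{G₁}` is purely inseparable (on function fields: every `G₁`-invariant `a` has
`a ^ q ^ n = π₁♯ c` with `c` `G`-invariant, `q = ringExpChar K(X)`) and
`π₁⁻¹ Z ⊆ ⋃ⱼ σⱼ(Y₁) ∪ f₁⁻¹(D₁)`.
Proof: apply `h59` to `(fc : X' → Y, G, φ⁻¹ Z)` — `φ⁻¹ Z` is closed, `≠ X'` since the dominant `φ`
meets the non-empty open `X ∖ Z`, and `G`-stable since `φ` is equivariant — and set `Y₁ := S₁`,
`q₁ := ψ ≫ q`, `π₁ := φ₁ ≫ φ`, `D₁ := D`. The action on `S₁` is over `k` (`ψ` equivariant, `ρY`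
over `k`); `dim S₁ = dim Y = d`; `(ρS₁ g) '' D = D` from `⊆` applied to `g` and `g⁻¹`; `φ₁ ≫ φ` is
an alteration (alteration then modification, de Jong 1996, 2.20), dominant and `χ`-equivariant;
`f₁ ≫ ψ ≫ q = φ₁ ≫ fc ≫ q = φ₁ ≫ φ ≫ f`; for the invariants, `a ^ q ^ n = φ₁♯ c` with
`c ∈ K(X')^G` and `c = φ♯ c'` with `c' ∈ K(X)^G` (`φ♯` is bijective for the modification `φ` and
commutes with the actions), so `a ^ q ^ n = (φ₁ ≫ φ)♯ c'` by `(φ₁ ≫ φ)♯ = φ₁♯ ∘ φ♯`, the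
exponential characteristics of `K(X')` and `K(X)` agreeing along `φ♯`; finally
`(φ₁ ≫ φ)⁻¹ Z = φ₁⁻¹ (φ⁻¹ Z) ⊆ ⋃ⱼ σⱼ(S₁) ∪ f₁⁻¹(D)` is clause (b) of Thm. 5.9.
[cite: DeJong1997, Thm. 5.9 and Situation 5.8, pp. 615–617; 5.3–5.4, pp. 613–614; proof of Thm. 5.13, p. 619]
[cite: DeJong1996, 2.17 and 2.20, pp. 59–61] -/
theorem stub_pair_equivariantSemiStableReduction_of_deJong59
    (h59 : DeJong1997_quasiSplitSemiStableCurveFibration.{0}) (k : Type) [Field k] (d : ℕ)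
    (X : Scheme.{0}) [IsIntegral X] (f : X ⟶ Spec (.of k))
    (G : Type) [Group G] [Finite G] (ρ : G →* Aut X)
    (Z : Set X) (hZ : IsClosed Z) (hZne : Z ≠ Set.univ)
    (hZG : ∀ g : G, (ρ g).hom.base '' Z ⊆ Z)
    (X' : Scheme.{0}) [IsIntegral X'] (φ : X' ⟶ X) (ρX' : G →* Aut X') (Y : Scheme.{0})
    [IsIntegral Y] (q : Y ⟶ Spec (.of k)) (ρY : G →* Aut Y) (fc : X' ⟶ Y)
    (hφ : IsModification φ) (hφG : ∀ g : G, (ρX' g).hom ≫ φ = φ ≫ (ρ g).hom)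
    (hprojX' : Motives.IsProjectiveOver (Over.mk (φ ≫ f))) (hprojY : Motives.IsProjectiveOver (Over.mk q))
    (hρY : ∀ g : G, (ρY g).hom ≫ q = q) (hfcG : ∀ g : G, (ρX' g).hom ≫ fc = fc ≫ (ρY g).hom)
    (hcomm : fc ≫ q = φ ≫ f) (hdimY : topologicalKrullDim Y = (d : ℕ))
    (hfib : topologicalKrullDim ↥(fc.fiber (genericPoint Y)) = 1)
    (hgi : GeometricallyIrreducible (fc.fiberToSpecResidueField (genericPoint Y))) :
    ∃ (G₁ : Type) (_ : Group G₁) (_ : Finite G₁) (X₁ Y₁ : Scheme.{0}) (_ : IsIntegral X₁)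
      (_ : IsIntegral Y₁) (f₁ : X₁ ⟶ Y₁) (q₁ : Y₁ ⟶ Spec (.of k)) (ρX₁ : G₁ →* Aut X₁)
      (ρY₁ : G₁ →* Aut Y₁) (D₁ : Set Y₁) (hD₁ : IsClosed D₁) (m : ℕ) (σ : Fin m → (Y₁ ⟶ X₁)),
  Motives.IsProjectiveOver (Over.mk (f₁ ≫ q₁)) ∧
      Motives.IsProjectiveOver (Over.mk q₁) ∧
      (∀ g : G₁, (ρY₁ g).hom ≫ q₁ = q₁) ∧
      topologicalKrullDim Y₁ ≤ (d : ℕ) ∧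
      D₁ ≠ Set.univ ∧
      (∀ g : G₁, (ρY₁ g).hom.base '' D₁ = D₁) ∧
      IsSemiStableCurve f₁ ∧
      (∀ x : X₁, (¬ ∃ U : X₁.Opens, x ∈ U ∧ Smooth (U.ι ≫ f₁)) →
        ∃ e : AdicCompletion
            ((IsLocalRing.maximalIdeal (X₁.presheaf.stalk x)).map (Ideal.Quotient.mk
              ((IsLocalRing.maximalIdeal (Y₁.presheaf.stalk (f₁.base x))).map (f₁.stalkMap x).hom)))
            (X₁.presheaf.stalk x ⧸
              (IsLocalRing.maximalIdeal (Y₁.presheaf.stalk (f₁.base x))).map (f₁.stalkMap x).hom) ≃+*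
          MvPowerSeries (Fin 2) (Y₁.presheaf.stalk (f₁.base x) ⧸ IsLocalRing.maximalIdeal (Y₁.presheaf.stalk (f₁.base x))) ⧸
            Ideal.span {(MvPowerSeries.X 0 * MvPowerSeries.X 1 :
              MvPowerSeries (Fin 2) (Y₁.presheaf.stalk (f₁.base x) ⧸ IsLocalRing.maximalIdeal (Y₁.presheaf.stalk (f₁.base x))))},
          e.toRingHom.comp ((algebraMap (X₁.presheaf.stalk x ⧸
              (IsLocalRing.maximalIdeal (Y₁.presheaf.stalk (f₁.base x))).map (f₁.stalkMap x).hom) _).comp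
            (Ideal.quotientMap ((IsLocalRing.maximalIdeal (Y₁.presheaf.stalk (f₁.base x))).map (f₁.stalkMap x).hom)
              (f₁.stalkMap x).hom Ideal.le_comap_map)) =
          algebraMap (Y₁.presheaf.stalk (f₁.base x) ⧸ IsLocalRing.maximalIdeal (Y₁.presheaf.stalk (f₁.base x))) _) ∧
      Smooth (f₁ ∣_ ⟨D₁ᶜ, hD₁.isOpen_compl⟩) ∧
      GeometricallyIrreducible (f₁.fiberToSpecResidueField (genericPoint Y₁)) ∧
      (∀ i : Fin m, σ i ≫ f₁ = 𝟙 Y₁) ∧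
      (Pairwise fun i j : Fin m => Disjoint (Set.range (σ i)) (Set.range (σ j))) ∧
      (∀ i : Fin m, ∃ U : X₁.Opens, Set.range (σ i) ⊆ (U : Set X₁) ∧ Smooth (U.ι ≫ f₁)) ∧
      (∀ g : G₁, (ρX₁ g).hom ≫ f₁ = f₁ ≫ (ρY₁ g).hom) ∧
      (∀ (g : G₁) (i : Fin m), ∃ j : Fin m, σ i ≫ (ρX₁ g).hom = (ρY₁ g).hom ≫ σ j) ∧
      ∃ (φ₁ : G₁ →* G) (π₁ : X₁ ⟶ X) (_ : IsDominant π₁),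
        Function.Surjective φ₁ ∧
        IsAlteration π₁ ∧
        f₁ ≫ q₁ = π₁ ≫ f ∧
        (∀ g : G₁, (ρX₁ g).hom ≫ π₁ = π₁ ≫ (ρ (φ₁ g)).hom) ∧
        (∀ a : X₁.functionField, (∀ g : G₁, RatFn.functionFieldMap (ρX₁ g).hom a = a) →
          ∃ (n : ℕ) (c : X.functionField), (∀ g : G, RatFn.functionFieldMap (ρ g).hom c = c) ∧
            a ^ ringExpChar X.functionField ^ n = RatFn.functionFieldMap π₁ c) ∧
        π₁.base ⁻¹' Z ⊆ DeJong1996.semiStableBoundary f₁ D₁ σ := by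
  haveI : IsDominant φ := hφ.isDominant
  -- `X'` is projective over `k` via `fc ≫ q = φ ≫ f`
  have hprojX'c : Motives.IsProjectiveOver (Over.mk (fc ≫ q)) := by rw [hcomm]; exact hprojX'
  -- the closed `G`-stable subset `φ⁻¹ Z ≠ X'`
  have hZ'c : IsClosed (φ.base ⁻¹' Z) := hZ.preimage φ.continuous
  have hZ'ne : φ.base ⁻¹' Z ≠ Set.univ := by
    intro huniv
    obtain ⟨x', hx'⟩ := φ.denseRange.exists_mem_open hZ.isOpen_compl
      (Set.nonempty_compl.mpr hZne)
    exact hx' (show x' ∈ φ.base ⁻¹' Z from huniv ▸ Set.mem_univ _)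
  have hZ'G : ∀ g : G, (ρX' g).hom.base '' (φ.base ⁻¹' Z) ⊆ φ.base ⁻¹' Z := fun g =>
    (preimage_image_eq_of_equivariant φ ρX' ρ hφG Z (image_eq_of_forall_image_subset ρ Z hZG) g).le
  -- de Jong 1997, Thm. 5.9 (`d = 1`) for `(fc : X' → Y, G, φ⁻¹ Z)`
  obtain ⟨G₁, _, _, X₁, S₁, _, _, f₁, ψ, _, φ₁, _, χ, ρX₁, ρS₁, D, hD, m, σ, hχ, -, hprojS₁,
      hdimS₁, hψG, -, hss, hprojX₁, hqs, hDne, hDG, hσf, hσdisj, hσsm, hsmooth, hf₁G, hσG, hgi₁,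
      hφ₁alt, hsq, hφ₁G, hφ₁gal, -, hZ₁⟩ :=
    h59 k X' Y q fc G ρX' ρY hprojX'c hprojY hρY hfcG hfib hgi (φ.base ⁻¹' Z) hZ'c hZ'ne hZ'G
  haveI : IsDominant (φ₁ ≫ φ) := inferInstance
  -- the exponential characteristics of `K(X)` and `K(X')` agree along the field map `φ♯`
  obtain ⟨p, hp⟩ := ExpChar.exists X.functionField
  haveI : ExpChar X'.functionField p :=
    expChar_of_injective_ringHom (RatFn.functionFieldMap φ).injective p
  have hpX : ringExpChar X.functionField = p := ringExpChar.eq _ p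
  have hpX' : ringExpChar X'.functionField = p := ringExpChar.eq _ p
  refine ⟨G₁, inferInstance, inferInstance, X₁, S₁, inferInstance, inferInstance, f₁, ψ ≫ q, ρX₁,
    ρS₁, D, hD, m, σ, hprojX₁, hprojS₁, fun g => ?_, le_of_eq (hdimS₁.trans hdimY), hDne,
    image_eq_of_forall_image_subset ρS₁ D hDG, hss, hqs, hsmooth, hgi₁, hσf, hσdisj, hσsm, hf₁G,
    hσG, χ, φ₁ ≫ φ, inferInstance, hχ, hφ₁alt.comp hφ.isAlteration, ?_, fun g => ?_,
    fun a ha => ?_, fun x hx => hZ₁ hx⟩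
  · -- the action on `S₁` is over `k`
    rw [← Category.assoc, hψG g, Category.assoc, hρY (χ g)]
  · -- `f₁ ≫ ψ ≫ q = φ₁ ≫ fc ≫ q = φ₁ ≫ φ ≫ f`
    rw [reassoc_of% hsq, hcomm, Category.assoc]
  · -- equivariance of `φ₁ ≫ φ`
    rw [← Category.assoc, hφ₁G g, Category.assoc, hφG (χ g), Category.assoc]
  · -- invariants: down to `X'` by Thm. 5.9 (a), then to `X` along the equivariant modification `φ`
    obtain ⟨n, c, hc, hac⟩ := hφ₁gal a ha
    obtain ⟨n', c', hc', hcc'⟩ := invariants_of_equivariant_of_mem_range φ ρX' ρ (MonoidHom.id G)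
      (fun g => ⟨g, rfl⟩) (fun g => by simpa using hφG g) c hc
      ((functionFieldMap_bijective_of_isModification φ hφ).2 c)
    refine ⟨n + n', c', hc', ?_⟩
    rw [hpX] at hcc' ⊢
    rw [hpX'] at hac
    rw [RatFn.functionFieldMap_comp φ φ₁, RingHom.comp_apply, ← hcc', map_pow, ← hac, ← pow_mul,
      ← pow_add]

end Summit.ResolutionOfSingularities.ResolutionOfSingularities.Theorems

end
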